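import Summits.Ventures.CertifiedManyBodySolver.Downfold.EmeryAxialSlabTl2201Subs
import Summits.Ventures.CertifiedManyBodySolver.Downfold.EmeryFermiFillingTl2201
import Summits.Ventures.CertifiedManyBodySolver.Downfold.EmeryFermiFillingLa214
import Summits.Ventures.CertifiedManyBodySolver.Downfold.EmeryAxialConductionBand
import HarnessLib

/-!
# Tl₂Ba₂CuO₆ (box #34 Tl-2201, (K) source rows; one-body rows are a POINT): HOW MUCH AXIAL (Cu-4s / apical) ADMIXTURE DOES THE BOX'S ONE-BAND FERMI SURFACE REQUIRE? — the certified
# co-shift census of the typed 3BE one-body box `emeryBoxTl2201K26Src` against its object-E row `t′/t ∈ [-0.425, -0.324]`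

Venture CertifiedManyBodySolver, cell `pub/hubbard-downfold` (stage S1, HUMAN RULINGS D-0096/D-0098: the 3 → 1 reduction error is carried explicitly),
seat hubbard-downfold-mod-4 (technique B = band level); namespace `Summit.Ventures.CertifiedManyBodySolver.Downfold.Emery`. Everything PROVED; numerics
decided by the kernel in `EmeryAxialSlabTl2201Subs`.

CONTEXT. `EmeryFermiFillingTl2201…` certified the σ three-band (d–p_x–p_y + t_pp, t_pp′) Fermi-surface `t′/t` window of this box at its own
hole count and compared it with the box's object-E row (router/BOXES/Tl2Ba2CuO6.md l.31 «tp/t (E) [−0.425, −0.324]»). `EmeryAxialFermiSurfaceShape` +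
`EmeryAxialConductionBand` (TRANSFER THEOREM `condBand_le_iff`, no separation hypothesis) prove that the four-orbital model of [AndersenEtAl1995] /
[PavariniEtAl2001] — Cu-4s (and through it the apical orbitals) added to the σ model — has, AT ITS FERMI LEVEL, exactly the conduction-band occupied
set, filling and Fermi surface of the σ model with CO-SHIFTED O–O hoppings `(t_pp + a, t_pp′ + a)`, ONE scalar `a = a_F = t_sp²/(ε_s − ε_F) ≥ 0`.
So «how much axial channel does the one-band FS of record require beyond the box's σ rows?» is a one-parameter question, answered here slab by slab
(sub-box rule version B, `EmeryFermiFillingSubBoxB`; edges 0, 0.02, 0.04, 0.06, 0.08, 0.1, 0.25, 0.4, 0.45, 0.5, 0.55, 0.6, 0.65, 0.75, 0.85 eV; Δ_pd × t_pd split 1 × 1):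

| slab | a (eV) | ε_F window (eV above ε_d) | certified t′/t window | vs E row [-0.425, -0.324] |
|---|---|---|---|---|
| 0 | [0, 0.02] | [1.5, 1.7] | [-0.2962, -0.2851] | SHORT |
| 1 | [0.02, 0.04] | [1.48, 1.68] | [-0.3047, -0.2943] | SHORT |
| 2 | [0.04, 0.06] | [1.46, 1.68] | [-0.3129, -0.303] | SHORT |
| 3 | [0.06, 0.08] | [1.46, 1.66] | [-0.3206, -0.3116] | SHORT |
| 4 | [0.08, 0.1] | [1.44, 1.64] | [-0.3284, -0.3195] | MEETS |
| 5 | [0.1, 0.25] | [1.32, 1.7] | [-0.381, -0.3264] | INSIDE |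
| 6 | [0.25, 0.4] | [1.24, 1.64] | [-0.4199, -0.3706] | INSIDE |
| 7 | [0.4, 0.45] | [1.22, 1.54] | [-0.427, -0.4042] | MEETS |
| 8 | [0.45, 0.5] | [1.22, 1.52] | [-0.4363, -0.4137] | MEETS |
| 9 | [0.5, 0.55] | [1.2, 1.52] | [-0.4459, -0.4218] | MEETS |
| 10 | [0.55, 0.6] | [1.18, 1.5] | [-0.4537, -0.4291] | OVERSHOOT |
| 11 | [0.6, 0.65] | [1.14, 1.48] | [-0.4608, -0.4348] | OVERSHOOT |
| 12 | [0.65, 0.75] | [1.1, 1.5] | [-0.4773, -0.4398] | OVERSHOOT |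
| 13 | [0.75, 0.85] | [1.08, 1.46] | [-0.4877, -0.451] | OVERSHOOT |

READING (certified, numbers not adjectives): `a ∈ [0, 0.08]` ⇒ the co-shifted Fermi surface is STILL LESS cuprate-like than the E row (`t′/t > -0.324`): the REQUIRED axial admixture at the Fermi level is `a_F > 0.08` eV (`emeryBoxTl2201K26Src_axial_short`); `a ∈ [0.1, 0.4]` ⇒ the co-shifted window lies INSIDE the E row (`emeryBoxTl2201K26Src_axial_inside`); `a ∈ [0.55, 0.85]` ⇒ OVERSHOOT, `t′/t < -0.425` (`emeryBoxTl2201K26Src_axial_overshoot`): `a_F < 0.55` eV. The four-orbital form of the exclusion(s) is `emeryBoxTl2201K26Src_fourOrbital_short` / `_fourOrbital_overshoot`: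
for ANY axial level `ε_s` and coupling `t_sp`, a four-orbital completion of a box point whose conduction band holds the box's electrons at a Fermi level `ε_F < ε_s`
with `t_sp²/(ε_s − ε_F)` in the excluded range does NOT reproduce the E row. (Pavarini's range parameter for the PURE four-orbital model is
`r = ½/(1 + s)`, `s = (ε_s − ε_F)(ε_F − ε_p)/(2t_sp)² = (ε_F + Δ_pd)/(4·a_total)`, where `a_total` would be the WHOLE O–O co-shift; the box's `t_pp, t_pp′` rows
already contain part of the axial channel when they come from a three-band Wannier fit, so `a_F` here is the ADDITIONAL admixture — a model-form
distance, not a material constant.)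

WHAT THIS IS NOT: not a statement that the material's parameters ARE in the box (SCREENING-GRADE provenance); `U = 0` band kinematics; no phase
sentence; the E row is a [float] literature refit. Sources: [AndersenEtAl1995, §§5–6]; [PavariniEtAl2001, Eqs. (1)–(3), Fig. 3];
[HybertsenSchluterChristensen1989, Eq. (1)].
-/

noncomputable section

namespace Summit.Ventures.CertifiedManyBodySolver.Downfold.Emery

open Real Set
open Summit.Ventures.CertifiedManyBodySolver.Downfold

/-! ## §2 The typed box and the co-shift as a parameter -/

/-- The one-body rows and the per-spin filling of `emeryBoxTl2201K26Src` read by this file. [folklore] -/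
theorem emeryBoxTl2201K26Src_axRows {p : EmeryCoord → ℝ} (hp : emeryBoxTl2201K26Src.Mem p) :
    p .DeltaPd ∈ Set.Icc (179 / 100 : ℝ) (179 / 100 : ℝ) ∧ p .tpd ∈ Set.Icc (127 / 100 : ℝ) (127 / 100 : ℝ) ∧
      p .tpp ∈ Set.Icc (63 / 100 : ℝ) (63 / 100 : ℝ) ∧ p .tppP ∈ Set.Icc (3 / 20 : ℝ) (3 / 20 : ℝ) ∧
      (2 - p .nHoles) / 2 ∈ Set.Icc (7 / 20 : ℝ) (3 / 8 : ℝ) := by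
  obtain ⟨hΔ, ha, hb, hc, hn⟩ := emeryBoxTl2201K26Src_mem_rows hp
  exact ⟨hΔ, ha, hb, hc, abFilling_rowTl2201_of_nHoles hn.1 hn.2 rfl⟩

/-- **Slab 0 on the typed box**: for every parameter vector of `emeryBoxTl2201K26Src`, every co-shift `a ∈ [0, 0.02]` and every Fermi energy at
which the CO-SHIFTED σ antibonding band holds the box's electrons: `ε ∈ [1.5, 1.7]`, `t′/t ∈ [-0.2962, -0.2851]` (SHORT).
[folklore] -/
theorem emeryBoxTl2201K26Src_axSlab0 :
    HoldsOn (fun p : EmeryCoord → ℝ => ∀ a ε : ℝ, a ∈ Set.Icc (0 : ℝ) (1 / 50 : ℝ) →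
      abFilling (p .DeltaPd) (p .tpd) (p .tpp + a) (p .tppP + a) ε = (2 - p .nHoles) / 2 →
      ε ∈ Set.Icc (3 / 2 : ℝ) (17 / 10 : ℝ) ∧
      fsRatio (p .DeltaPd) (p .tpd) (p .tpp + a) (p .tppP + a) ε ∈ Set.Icc (-(1481 / 5000 : ℝ)) (-(2851 / 10000 : ℝ))) emeryBoxTl2201K26Src := by
  intro p hp a ε ha' hf
  obtain ⟨hΔ, ha, hb, hc, hν⟩ := emeryBoxTl2201K26Src_axRows hp
  rw [← hf] at hν
  exact tl2201Ax0Sub_0_0 hΔ ha ⟨by linarith [hb.1, ha'.1], by linarith [hb.2, ha'.2]⟩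
    ⟨by linarith [hc.1, ha'.1], by linarith [hc.2, ha'.2]⟩ hν

/-- **Slab 1 on the typed box**: for every parameter vector of `emeryBoxTl2201K26Src`, every co-shift `a ∈ [0.02, 0.04]` and every Fermi energy at
which the CO-SHIFTED σ antibonding band holds the box's electrons: `ε ∈ [1.48, 1.68]`, `t′/t ∈ [-0.3047, -0.2943]` (SHORT).
[folklore] -/
theorem emeryBoxTl2201K26Src_axSlab1 :
    HoldsOn (fun p : EmeryCoord → ℝ => ∀ a ε : ℝ, a ∈ Set.Icc (1 / 50 : ℝ) (1 / 25 : ℝ) →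
      abFilling (p .DeltaPd) (p .tpd) (p .tpp + a) (p .tppP + a) ε = (2 - p .nHoles) / 2 →
      ε ∈ Set.Icc (37 / 25 : ℝ) (42 / 25 : ℝ) ∧
      fsRatio (p .DeltaPd) (p .tpd) (p .tpp + a) (p .tppP + a) ε ∈ Set.Icc (-(3047 / 10000 : ℝ)) (-(2943 / 10000 : ℝ))) emeryBoxTl2201K26Src := by
  intro p hp a ε ha' hf
  obtain ⟨hΔ, ha, hb, hc, hν⟩ := emeryBoxTl2201K26Src_axRows hp
  rw [← hf] at hν
  exact tl2201Ax1Sub_0_0 hΔ ha ⟨by linarith [hb.1, ha'.1], by linarith [hb.2, ha'.2]⟩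
    ⟨by linarith [hc.1, ha'.1], by linarith [hc.2, ha'.2]⟩ hν

/-- **Slab 2 on the typed box**: for every parameter vector of `emeryBoxTl2201K26Src`, every co-shift `a ∈ [0.04, 0.06]` and every Fermi energy at
which the CO-SHIFTED σ antibonding band holds the box's electrons: `ε ∈ [1.46, 1.68]`, `t′/t ∈ [-0.3129, -0.303]` (SHORT).
[folklore] -/
theorem emeryBoxTl2201K26Src_axSlab2 :
    HoldsOn (fun p : EmeryCoord → ℝ => ∀ a ε : ℝ, a ∈ Set.Icc (1 / 25 : ℝ) (3 / 50 : ℝ) →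
      abFilling (p .DeltaPd) (p .tpd) (p .tpp + a) (p .tppP + a) ε = (2 - p .nHoles) / 2 →
      ε ∈ Set.Icc (73 / 50 : ℝ) (42 / 25 : ℝ) ∧
      fsRatio (p .DeltaPd) (p .tpd) (p .tpp + a) (p .tppP + a) ε ∈ Set.Icc (-(3129 / 10000 : ℝ)) (-(303 / 1000 : ℝ))) emeryBoxTl2201K26Src := by
  intro p hp a ε ha' hf
  obtain ⟨hΔ, ha, hb, hc, hν⟩ := emeryBoxTl2201K26Src_axRows hp
  rw [← hf] at hν
  exact tl2201Ax2Sub_0_0 hΔ ha ⟨by linarith [hb.1, ha'.1], by linarith [hb.2, ha'.2]⟩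
    ⟨by linarith [hc.1, ha'.1], by linarith [hc.2, ha'.2]⟩ hν

/-- **Slab 3 on the typed box**: for every parameter vector of `emeryBoxTl2201K26Src`, every co-shift `a ∈ [0.06, 0.08]` and every Fermi energy at
which the CO-SHIFTED σ antibonding band holds the box's electrons: `ε ∈ [1.46, 1.66]`, `t′/t ∈ [-0.3206, -0.3116]` (SHORT).
[folklore] -/
theorem emeryBoxTl2201K26Src_axSlab3 :
    HoldsOn (fun p : EmeryCoord → ℝ => ∀ a ε : ℝ, a ∈ Set.Icc (3 / 50 : ℝ) (2 / 25 : ℝ) →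
      abFilling (p .DeltaPd) (p .tpd) (p .tpp + a) (p .tppP + a) ε = (2 - p .nHoles) / 2 →
      ε ∈ Set.Icc (73 / 50 : ℝ) (83 / 50 : ℝ) ∧
      fsRatio (p .DeltaPd) (p .tpd) (p .tpp + a) (p .tppP + a) ε ∈ Set.Icc (-(1603 / 5000 : ℝ)) (-(779 / 2500 : ℝ))) emeryBoxTl2201K26Src := by
  intro p hp a ε ha' hf
  obtain ⟨hΔ, ha, hb, hc, hν⟩ := emeryBoxTl2201K26Src_axRows hp
  rw [← hf] at hν
  exact tl2201Ax3Sub_0_0 hΔ ha ⟨by linarith [hb.1, ha'.1], by linarith [hb.2, ha'.2]⟩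
    ⟨by linarith [hc.1, ha'.1], by linarith [hc.2, ha'.2]⟩ hν

/-- **Slab 4 on the typed box**: for every parameter vector of `emeryBoxTl2201K26Src`, every co-shift `a ∈ [0.08, 0.1]` and every Fermi energy at
which the CO-SHIFTED σ antibonding band holds the box's electrons: `ε ∈ [1.44, 1.64]`, `t′/t ∈ [-0.3284, -0.3195]` (MEETS).
[folklore] -/
theorem emeryBoxTl2201K26Src_axSlab4 :
    HoldsOn (fun p : EmeryCoord → ℝ => ∀ a ε : ℝ, a ∈ Set.Icc (2 / 25 : ℝ) (1 / 10 : ℝ) →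
      abFilling (p .DeltaPd) (p .tpd) (p .tpp + a) (p .tppP + a) ε = (2 - p .nHoles) / 2 →
      ε ∈ Set.Icc (36 / 25 : ℝ) (41 / 25 : ℝ) ∧
      fsRatio (p .DeltaPd) (p .tpd) (p .tpp + a) (p .tppP + a) ε ∈ Set.Icc (-(821 / 2500 : ℝ)) (-(639 / 2000 : ℝ))) emeryBoxTl2201K26Src := by
  intro p hp a ε ha' hf
  obtain ⟨hΔ, ha, hb, hc, hν⟩ := emeryBoxTl2201K26Src_axRows hp
  rw [← hf] at hν
  exact tl2201Ax4Sub_0_0 hΔ ha ⟨by linarith [hb.1, ha'.1], by linarith [hb.2, ha'.2]⟩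
    ⟨by linarith [hc.1, ha'.1], by linarith [hc.2, ha'.2]⟩ hν

/-- **Slab 5 on the typed box**: for every parameter vector of `emeryBoxTl2201K26Src`, every co-shift `a ∈ [0.1, 0.25]` and every Fermi energy at
which the CO-SHIFTED σ antibonding band holds the box's electrons: `ε ∈ [1.32, 1.7]`, `t′/t ∈ [-0.381, -0.3264]` (INSIDE).
[folklore] -/
theorem emeryBoxTl2201K26Src_axSlab5 :
    HoldsOn (fun p : EmeryCoord → ℝ => ∀ a ε : ℝ, a ∈ Set.Icc (1 / 10 : ℝ) (1 / 4 : ℝ) →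
      abFilling (p .DeltaPd) (p .tpd) (p .tpp + a) (p .tppP + a) ε = (2 - p .nHoles) / 2 →
      ε ∈ Set.Icc (33 / 25 : ℝ) (17 / 10 : ℝ) ∧
      fsRatio (p .DeltaPd) (p .tpd) (p .tpp + a) (p .tppP + a) ε ∈ Set.Icc (-(381 / 1000 : ℝ)) (-(204 / 625 : ℝ))) emeryBoxTl2201K26Src := by
  intro p hp a ε ha' hf
  obtain ⟨hΔ, ha, hb, hc, hν⟩ := emeryBoxTl2201K26Src_axRows hp
  rw [← hf] at hν
  exact tl2201Ax5Sub_0_0 hΔ ha ⟨by linarith [hb.1, ha'.1], by linarith [hb.2, ha'.2]⟩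
    ⟨by linarith [hc.1, ha'.1], by linarith [hc.2, ha'.2]⟩ hν

/-- **Slab 6 on the typed box**: for every parameter vector of `emeryBoxTl2201K26Src`, every co-shift `a ∈ [0.25, 0.4]` and every Fermi energy at
which the CO-SHIFTED σ antibonding band holds the box's electrons: `ε ∈ [1.24, 1.64]`, `t′/t ∈ [-0.4199, -0.3706]` (INSIDE).
[folklore] -/
theorem emeryBoxTl2201K26Src_axSlab6 :
    HoldsOn (fun p : EmeryCoord → ℝ => ∀ a ε : ℝ, a ∈ Set.Icc (1 / 4 : ℝ) (2 / 5 : ℝ) →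
      abFilling (p .DeltaPd) (p .tpd) (p .tpp + a) (p .tppP + a) ε = (2 - p .nHoles) / 2 →
      ε ∈ Set.Icc (31 / 25 : ℝ) (41 / 25 : ℝ) ∧
      fsRatio (p .DeltaPd) (p .tpd) (p .tpp + a) (p .tppP + a) ε ∈ Set.Icc (-(4199 / 10000 : ℝ)) (-(1853 / 5000 : ℝ))) emeryBoxTl2201K26Src := by
  intro p hp a ε ha' hf
  obtain ⟨hΔ, ha, hb, hc, hν⟩ := emeryBoxTl2201K26Src_axRows hp
  rw [← hf] at hν
  exact tl2201Ax6Sub_0_0 hΔ ha ⟨by linarith [hb.1, ha'.1], by linarith [hb.2, ha'.2]⟩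
    ⟨by linarith [hc.1, ha'.1], by linarith [hc.2, ha'.2]⟩ hν

/-- **Slab 7 on the typed box**: for every parameter vector of `emeryBoxTl2201K26Src`, every co-shift `a ∈ [0.4, 0.45]` and every Fermi energy at
which the CO-SHIFTED σ antibonding band holds the box's electrons: `ε ∈ [1.22, 1.54]`, `t′/t ∈ [-0.427, -0.4042]` (MEETS).
[folklore] -/
theorem emeryBoxTl2201K26Src_axSlab7 :
    HoldsOn (fun p : EmeryCoord → ℝ => ∀ a ε : ℝ, a ∈ Set.Icc (2 / 5 : ℝ) (9 / 20 : ℝ) →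
      abFilling (p .DeltaPd) (p .tpd) (p .tpp + a) (p .tppP + a) ε = (2 - p .nHoles) / 2 →
      ε ∈ Set.Icc (61 / 50 : ℝ) (77 / 50 : ℝ) ∧
      fsRatio (p .DeltaPd) (p .tpd) (p .tpp + a) (p .tppP + a) ε ∈ Set.Icc (-(427 / 1000 : ℝ)) (-(2021 / 5000 : ℝ))) emeryBoxTl2201K26Src := by
  intro p hp a ε ha' hf
  obtain ⟨hΔ, ha, hb, hc, hν⟩ := emeryBoxTl2201K26Src_axRows hp
  rw [← hf] at hν
  exact tl2201Ax7Sub_0_0 hΔ ha ⟨by linarith [hb.1, ha'.1], by linarith [hb.2, ha'.2]⟩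
    ⟨by linarith [hc.1, ha'.1], by linarith [hc.2, ha'.2]⟩ hν

/-- **Slab 8 on the typed box**: for every parameter vector of `emeryBoxTl2201K26Src`, every co-shift `a ∈ [0.45, 0.5]` and every Fermi energy at
which the CO-SHIFTED σ antibonding band holds the box's electrons: `ε ∈ [1.22, 1.52]`, `t′/t ∈ [-0.4363, -0.4137]` (MEETS).
[folklore] -/
theorem emeryBoxTl2201K26Src_axSlab8 :
    HoldsOn (fun p : EmeryCoord → ℝ => ∀ a ε : ℝ, a ∈ Set.Icc (9 / 20 : ℝ) (1 / 2 : ℝ) →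
      abFilling (p .DeltaPd) (p .tpd) (p .tpp + a) (p .tppP + a) ε = (2 - p .nHoles) / 2 →
      ε ∈ Set.Icc (61 / 50 : ℝ) (38 / 25 : ℝ) ∧
      fsRatio (p .DeltaPd) (p .tpd) (p .tpp + a) (p .tppP + a) ε ∈ Set.Icc (-(4363 / 10000 : ℝ)) (-(4137 / 10000 : ℝ))) emeryBoxTl2201K26Src := by
  intro p hp a ε ha' hf
  obtain ⟨hΔ, ha, hb, hc, hν⟩ := emeryBoxTl2201K26Src_axRows hp
  rw [← hf] at hν
  exact tl2201Ax8Sub_0_0 hΔ ha ⟨by linarith [hb.1, ha'.1], by linarith [hb.2, ha'.2]⟩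
    ⟨by linarith [hc.1, ha'.1], by linarith [hc.2, ha'.2]⟩ hν

/-- **Slab 9 on the typed box**: for every parameter vector of `emeryBoxTl2201K26Src`, every co-shift `a ∈ [0.5, 0.55]` and every Fermi energy at
which the CO-SHIFTED σ antibonding band holds the box's electrons: `ε ∈ [1.2, 1.52]`, `t′/t ∈ [-0.4459, -0.4218]` (MEETS).
[folklore] -/
theorem emeryBoxTl2201K26Src_axSlab9 :
    HoldsOn (fun p : EmeryCoord → ℝ => ∀ a ε : ℝ, a ∈ Set.Icc (1 / 2 : ℝ) (11 / 20 : ℝ) →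
      abFilling (p .DeltaPd) (p .tpd) (p .tpp + a) (p .tppP + a) ε = (2 - p .nHoles) / 2 →
      ε ∈ Set.Icc (6 / 5 : ℝ) (38 / 25 : ℝ) ∧
      fsRatio (p .DeltaPd) (p .tpd) (p .tpp + a) (p .tppP + a) ε ∈ Set.Icc (-(4459 / 10000 : ℝ)) (-(2109 / 5000 : ℝ))) emeryBoxTl2201K26Src := by
  intro p hp a ε ha' hf
  obtain ⟨hΔ, ha, hb, hc, hν⟩ := emeryBoxTl2201K26Src_axRows hp
  rw [← hf] at hν
  exact tl2201Ax9Sub_0_0 hΔ ha ⟨by linarith [hb.1, ha'.1], by linarith [hb.2, ha'.2]⟩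
    ⟨by linarith [hc.1, ha'.1], by linarith [hc.2, ha'.2]⟩ hν

/-- **Slab 10 on the typed box**: for every parameter vector of `emeryBoxTl2201K26Src`, every co-shift `a ∈ [0.55, 0.6]` and every Fermi energy at
which the CO-SHIFTED σ antibonding band holds the box's electrons: `ε ∈ [1.18, 1.5]`, `t′/t ∈ [-0.4537, -0.4291]` (OVERSHOOT).
[folklore] -/
theorem emeryBoxTl2201K26Src_axSlab10 :
    HoldsOn (fun p : EmeryCoord → ℝ => ∀ a ε : ℝ, a ∈ Set.Icc (11 / 20 : ℝ) (3 / 5 : ℝ) →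
      abFilling (p .DeltaPd) (p .tpd) (p .tpp + a) (p .tppP + a) ε = (2 - p .nHoles) / 2 →
      ε ∈ Set.Icc (59 / 50 : ℝ) (3 / 2 : ℝ) ∧
      fsRatio (p .DeltaPd) (p .tpd) (p .tpp + a) (p .tppP + a) ε ∈ Set.Icc (-(4537 / 10000 : ℝ)) (-(4291 / 10000 : ℝ))) emeryBoxTl2201K26Src := by
  intro p hp a ε ha' hf
  obtain ⟨hΔ, ha, hb, hc, hν⟩ := emeryBoxTl2201K26Src_axRows hp
  rw [← hf] at hν
  exact tl2201Ax10Sub_0_0 hΔ ha ⟨by linarith [hb.1, ha'.1], by linarith [hb.2, ha'.2]⟩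
    ⟨by linarith [hc.1, ha'.1], by linarith [hc.2, ha'.2]⟩ hν

/-- **Slab 11 on the typed box**: for every parameter vector of `emeryBoxTl2201K26Src`, every co-shift `a ∈ [0.6, 0.65]` and every Fermi energy at
which the CO-SHIFTED σ antibonding band holds the box's electrons: `ε ∈ [1.14, 1.48]`, `t′/t ∈ [-0.4608, -0.4348]` (OVERSHOOT).
[folklore] -/
theorem emeryBoxTl2201K26Src_axSlab11 :
    HoldsOn (fun p : EmeryCoord → ℝ => ∀ a ε : ℝ, a ∈ Set.Icc (3 / 5 : ℝ) (13 / 20 : ℝ) →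
      abFilling (p .DeltaPd) (p .tpd) (p .tpp + a) (p .tppP + a) ε = (2 - p .nHoles) / 2 →
      ε ∈ Set.Icc (57 / 50 : ℝ) (37 / 25 : ℝ) ∧
      fsRatio (p .DeltaPd) (p .tpd) (p .tpp + a) (p .tppP + a) ε ∈ Set.Icc (-(288 / 625 : ℝ)) (-(1087 / 2500 : ℝ))) emeryBoxTl2201K26Src := by
  intro p hp a ε ha' hf
  obtain ⟨hΔ, ha, hb, hc, hν⟩ := emeryBoxTl2201K26Src_axRows hp
  rw [← hf] at hν
  exact tl2201Ax11Sub_0_0 hΔ ha ⟨by linarith [hb.1, ha'.1], by linarith [hb.2, ha'.2]⟩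
    ⟨by linarith [hc.1, ha'.1], by linarith [hc.2, ha'.2]⟩ hν

/-- **Slab 12 on the typed box**: for every parameter vector of `emeryBoxTl2201K26Src`, every co-shift `a ∈ [0.65, 0.75]` and every Fermi energy at
which the CO-SHIFTED σ antibonding band holds the box's electrons: `ε ∈ [1.1, 1.5]`, `t′/t ∈ [-0.4773, -0.4398]` (OVERSHOOT).
[folklore] -/
theorem emeryBoxTl2201K26Src_axSlab12 :
    HoldsOn (fun p : EmeryCoord → ℝ => ∀ a ε : ℝ, a ∈ Set.Icc (13 / 20 : ℝ) (3 / 4 : ℝ) →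
      abFilling (p .DeltaPd) (p .tpd) (p .tpp + a) (p .tppP + a) ε = (2 - p .nHoles) / 2 →
      ε ∈ Set.Icc (11 / 10 : ℝ) (3 / 2 : ℝ) ∧
      fsRatio (p .DeltaPd) (p .tpd) (p .tpp + a) (p .tppP + a) ε ∈ Set.Icc (-(4773 / 10000 : ℝ)) (-(2199 / 5000 : ℝ))) emeryBoxTl2201K26Src := by
  intro p hp a ε ha' hf
  obtain ⟨hΔ, ha, hb, hc, hν⟩ := emeryBoxTl2201K26Src_axRows hp
  rw [← hf] at hν
  exact tl2201Ax12Sub_0_0 hΔ ha ⟨by linarith [hb.1, ha'.1], by linarith [hb.2, ha'.2]⟩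
    ⟨by linarith [hc.1, ha'.1], by linarith [hc.2, ha'.2]⟩ hν

/-- **Slab 13 on the typed box**: for every parameter vector of `emeryBoxTl2201K26Src`, every co-shift `a ∈ [0.75, 0.85]` and every Fermi energy at
which the CO-SHIFTED σ antibonding band holds the box's electrons: `ε ∈ [1.08, 1.46]`, `t′/t ∈ [-0.4877, -0.451]` (OVERSHOOT).
[folklore] -/
theorem emeryBoxTl2201K26Src_axSlab13 :
    HoldsOn (fun p : EmeryCoord → ℝ => ∀ a ε : ℝ, a ∈ Set.Icc (3 / 4 : ℝ) (17 / 20 : ℝ) →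
      abFilling (p .DeltaPd) (p .tpd) (p .tpp + a) (p .tppP + a) ε = (2 - p .nHoles) / 2 →
      ε ∈ Set.Icc (27 / 25 : ℝ) (73 / 50 : ℝ) ∧
      fsRatio (p .DeltaPd) (p .tpd) (p .tpp + a) (p .tppP + a) ε ∈ Set.Icc (-(4877 / 10000 : ℝ)) (-(451 / 1000 : ℝ))) emeryBoxTl2201K26Src := by
  intro p hp a ε ha' hf
  obtain ⟨hΔ, ha, hb, hc, hν⟩ := emeryBoxTl2201K26Src_axRows hp
  rw [← hf] at hν
  exact tl2201Ax13Sub_0_0 hΔ ha ⟨by linarith [hb.1, ha'.1], by linarith [hb.2, ha'.2]⟩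
    ⟨by linarith [hc.1, ha'.1], by linarith [hc.2, ha'.2]⟩ hν

/-! ## §3 The census verdicts against the E row -/

/-- **STILL SHORT OF THE E ROW for every co-shift `a ∈ [0, 0.08]`**: the co-shifted σ (= four-orbital at the Fermi level) `t′/t` stays ABOVE
`-0.324` — the one-band Fermi surface of record REQUIRES an axial admixture `a_F > 0.08` eV beyond the box's σ rows. [folklore] -/
theorem emeryBoxTl2201K26Src_axial_short :
    HoldsOn (fun p : EmeryCoord → ℝ => ∀ a ε : ℝ, a ∈ Set.Icc (0 : ℝ) (2 / 25 : ℝ) →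
      abFilling (p .DeltaPd) (p .tpd) (p .tpp + a) (p .tppP + a) ε = (2 - p .nHoles) / 2 →
      (-(81 / 250 : ℝ)) < fsRatio (p .DeltaPd) (p .tpd) (p .tpp + a) (p .tppP + a) ε) emeryBoxTl2201K26Src := by
  intro p hp a ε ha' hf
  rcases mem_Icc_split ha' (1 / 25 : ℝ) with ha' | ha'
  · rcases mem_Icc_split ha' (1 / 50 : ℝ) with ha' | ha'
    · have h := (emeryBoxTl2201K26Src_axSlab0 p hp a ε ha' hf).2
      exact lt_of_lt_of_le (by norm_num) h.1
    · have h := (emeryBoxTl2201K26Src_axSlab1 p hp a ε ha' hf).2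
      exact lt_of_lt_of_le (by norm_num) h.1
  · rcases mem_Icc_split ha' (3 / 50 : ℝ) with ha' | ha'
    · have h := (emeryBoxTl2201K26Src_axSlab2 p hp a ε ha' hf).2
      exact lt_of_lt_of_le (by norm_num) h.1
    · have h := (emeryBoxTl2201K26Src_axSlab3 p hp a ε ha' hf).2
      exact lt_of_lt_of_le (by norm_num) h.1

/-- **OVERSHOOT for every co-shift `a ∈ [0.55, 0.85]`**: the co-shifted `t′/t` lies BELOW `-0.425` — more axial admixture than
`0.55` eV makes the Fermi surface MORE cuprate-like than the E row of record. [folklore] -/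
theorem emeryBoxTl2201K26Src_axial_overshoot :
    HoldsOn (fun p : EmeryCoord → ℝ => ∀ a ε : ℝ, a ∈ Set.Icc (11 / 20 : ℝ) (17 / 20 : ℝ) →
      abFilling (p .DeltaPd) (p .tpd) (p .tpp + a) (p .tppP + a) ε = (2 - p .nHoles) / 2 →
      fsRatio (p .DeltaPd) (p .tpd) (p .tpp + a) (p .tppP + a) ε < (-(17 / 40 : ℝ))) emeryBoxTl2201K26Src := by
  intro p hp a ε ha' hf
  rcases mem_Icc_split ha' (13 / 20 : ℝ) with ha' | ha'
  · rcases mem_Icc_split ha' (3 / 5 : ℝ) with ha' | ha'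
    · have h := (emeryBoxTl2201K26Src_axSlab10 p hp a ε ha' hf).2
      exact lt_of_le_of_lt h.2 (by norm_num)
    · have h := (emeryBoxTl2201K26Src_axSlab11 p hp a ε ha' hf).2
      exact lt_of_le_of_lt h.2 (by norm_num)
  · rcases mem_Icc_split ha' (3 / 4 : ℝ) with ha' | ha'
    · have h := (emeryBoxTl2201K26Src_axSlab12 p hp a ε ha' hf).2
      exact lt_of_le_of_lt h.2 (by norm_num)
    · have h := (emeryBoxTl2201K26Src_axSlab13 p hp a ε ha' hf).2
      exact lt_of_le_of_lt h.2 (by norm_num)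

/-- **INSIDE THE E ROW for every co-shift `a ∈ [0.1, 0.4]`**: the co-shifted `t′/t` lies in `[-0.425, -0.324]`. [folklore] -/
theorem emeryBoxTl2201K26Src_axial_inside :
    HoldsOn (fun p : EmeryCoord → ℝ => ∀ a ε : ℝ, a ∈ Set.Icc (1 / 10 : ℝ) (2 / 5 : ℝ) →
      abFilling (p .DeltaPd) (p .tpd) (p .tpp + a) (p .tppP + a) ε = (2 - p .nHoles) / 2 →
      fsRatio (p .DeltaPd) (p .tpd) (p .tpp + a) (p .tppP + a) ε ∈ Set.Icc (-(17 / 40 : ℝ)) (-(81 / 250 : ℝ))) emeryBoxTl2201K26Src := by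
  intro p hp a ε ha' hf
  rcases mem_Icc_split ha' (1 / 4 : ℝ) with ha' | ha'
  · have h := (emeryBoxTl2201K26Src_axSlab5 p hp a ε ha' hf).2
    exact ⟨le_trans (by norm_num) h.1, h.2.trans (by norm_num)⟩
  · have h := (emeryBoxTl2201K26Src_axSlab6 p hp a ε ha' hf).2
    exact ⟨le_trans (by norm_num) h.1, h.2.trans (by norm_num)⟩

/-! ## §4 The four-orbital reading (transfer theorem `EmeryAxialConductionBand.condFilling_eq_abFilling`) -/

/-- **FOUR-ORBITAL FORM OF THE SHORTFALL.** For every parameter vector of `emeryBoxTl2201K26Src`, EVERY axial level `ε_s` and coupling `t_sp`, and every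
Fermi energy `ε < ε_s` at which the four-orbital CONDUCTION band (`EmeryBandEigenvalues.band4 … 1`) holds the box's electrons: if the axial admixture
at the Fermi level `t_sp²/(ε_s − ε)` is at most `0.08` eV, the conduction-band Fermi surface (an exact `t–t′` contour,
`EmeryAxialConductionBand.oneBand_of_band4_one_eq`) has `t′/t > -0.324` — it does NOT reproduce the object-E row. [cite: PavariniEtAl2001, Eqs. (1)–(3), Fig. 3] -/
theorem emeryBoxTl2201K26Src_fourOrbital_short :
    HoldsOn (fun p : EmeryCoord → ℝ => ∀ εs tsp ε : ℝ, ε < εs →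
      tsp ^ 2 / (εs - ε) ≤ (2 / 25 : ℝ) →
      condFilling (p .DeltaPd) εs (p .tpd) (p .tpp) (p .tppP) tsp ε = (2 - p .nHoles) / 2 →
      (-(81 / 250 : ℝ)) < fsRatio (p .DeltaPd) (p .tpd) (p .tpp + tsp ^ 2 / (εs - ε)) (p .tppP + tsp ^ 2 / (εs - ε)) ε) emeryBoxTl2201K26Src := by
  intro p hp εs tsp ε hε ha hf
  rw [condFilling_eq_abFilling hε] at hf
  exact emeryBoxTl2201K26Src_axial_short p hp _ ε ⟨div_nonneg (sq_nonneg _) (sub_pos.mpr hε).le, ha⟩ hf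

/-- **FOUR-ORBITAL FORM OF THE OVERSHOOT**: axial admixture `t_sp²/(ε_s − ε_F) ∈ [0.55, 0.85]` eV puts the conduction-band
`t′/t` below `-0.425`. [cite: PavariniEtAl2001, Eqs. (1)–(3), Fig. 3] -/
theorem emeryBoxTl2201K26Src_fourOrbital_overshoot :
    HoldsOn (fun p : EmeryCoord → ℝ => ∀ εs tsp ε : ℝ, ε < εs →
      tsp ^ 2 / (εs - ε) ∈ Set.Icc (11 / 20 : ℝ) (17 / 20 : ℝ) →
      condFilling (p .DeltaPd) εs (p .tpd) (p .tpp) (p .tppP) tsp ε = (2 - p .nHoles) / 2 →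
      fsRatio (p .DeltaPd) (p .tpd) (p .tpp + tsp ^ 2 / (εs - ε)) (p .tppP + tsp ^ 2 / (εs - ε)) ε < (-(17 / 40 : ℝ))) emeryBoxTl2201K26Src := by
  intro p hp εs tsp ε hε ha hf
  rw [condFilling_eq_abFilling hε] at hf
  exact emeryBoxTl2201K26Src_axial_overshoot p hp _ ε ha hf

/-- **FOUR-ORBITAL FORM OF THE MATCH**: axial admixture `t_sp²/(ε_s − ε_F) ∈ [0.1, 0.4]` eV puts the conduction-band
`t′/t` INSIDE the E row `[-0.425, -0.324]`. [cite: PavariniEtAl2001, Eqs. (1)–(3), Fig. 3] -/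
theorem emeryBoxTl2201K26Src_fourOrbital_inside :
    HoldsOn (fun p : EmeryCoord → ℝ => ∀ εs tsp ε : ℝ, ε < εs →
      tsp ^ 2 / (εs - ε) ∈ Set.Icc (1 / 10 : ℝ) (2 / 5 : ℝ) →
      condFilling (p .DeltaPd) εs (p .tpd) (p .tpp) (p .tppP) tsp ε = (2 - p .nHoles) / 2 →
      fsRatio (p .DeltaPd) (p .tpd) (p .tpp + tsp ^ 2 / (εs - ε)) (p .tppP + tsp ^ 2 / (εs - ε)) ε
        ∈ Set.Icc (-(17 / 40 : ℝ)) (-(81 / 250 : ℝ))) emeryBoxTl2201K26Src := by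
  intro p hp εs tsp ε hε ha hf
  rw [condFilling_eq_abFilling hε] at hf
  exact emeryBoxTl2201K26Src_axial_inside p hp _ ε ha hf

end Summit.Ventures.CertifiedManyBodySolver.Downfold.Emery
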